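import Literature.Barriers.CriticalPhenomena.GaussianDominationRouteLemma84
import HarnessLib

/-!
# `HaraSlade1990_infraredBound_holds`: the Hara–Slade infrared bound (`d ≥ d₀`), DISCHARGED

Sibling proof file of `GaussianDominationRoute*.lean` (barrier catalogue
`Literature/Barriers/CriticalPhenomena/`; theorems only — no definition, no named fact). The named
fact `HaraSlade1990_infraredBound` (`GaussianDominationRoute.lean`; T. Hara, G. Slade, Comm. Math.
Phys. 128 (1990), Thm. 1.1 in the nearest-neighbour, `d ≥ d₀` form of M. Heydenreich,
R. van der Hofstad (2017), Thm. 5.1) is now a theorem, by composing two theorems of the tree: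

* `HaraSlade1990_infraredBound_of_lemma84 : HvdH2017_lemma84 → HaraSlade1990_infraredBound`
  (`GaussianDominationRouteLemma84Assembly.lean`: the bootstrap of Ch. 8 — Prop. 8.3, Prop. 8.8,
  Lemma 8.9, Prop. 8.10, (8.2.9)–(8.2.10) — from Lemma 8.4), and
* `HvdH2017_lemma84_holds : HvdH2017_lemma84` (`GaussianDominationRouteLemma84.lean`: Lemma 8.4
  from Lemma 7.1, Lemma 7.2, Prop. 7.4 and Lemmas 8.5–8.7, all proved).

## References

* T. Hara, G. Slade, *Mean-field critical behaviour for percolation in high dimensions*, Comm.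
  Math. Phys. 128 (1990) 333–391, Thm. 1.1. [HaraSlade1990]
* M. Heydenreich, R. van der Hofstad, *Progress in High-Dimensional Percolation and Random
  Graphs*, CRM Short Courses, Springer (2017), Thm. 5.1, Ch. 7–8. [HeydenreichVanDerHofstad2017]
-/

noncomputable section

namespace Literature.Barriers.CriticalPhenomena

/-- **The Hara–Slade infrared bound (`HaraSlade1990_infraredBound`), proved**: Heydenreich–van der
Hofstad's Thm. 5.1 assembled from Lemma 8.4 (`HvdH2017_lemma84_holds`) through the Ch. 8
bootstrap (`HaraSlade1990_infraredBound_of_lemma84`).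
[cite: HaraSlade1990, Thm. 1.1] [cite: HeydenreichVanDerHofstad2017, Thm. 5.1 (proof, Ch. 8, (8.2.9)–(8.2.10))] -/
theorem HaraSlade1990_infraredBound_holds : HaraSlade1990_infraredBound :=
  HaraSlade1990_infraredBound_of_lemma84 HvdH2017_lemma84_holds

end Literature.Barriers.CriticalPhenomena

end
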